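import Summits.CriticalPhenomena.PercolationContinuityZ3.Theorems.PercNearOneGluingNoHeavyQuantBudgetFlow
import Summits.CriticalPhenomena.PercolationContinuityZ3.Theorems.PercNearOneGluingNoHeavyQuantGluedForestSDEC
import Summits.CriticalPhenomena.PercolationContinuityZ3.Theorems.PercNearOneGluingNoHeavyQuantResidDEC
import HarnessLib

/-!
# QUANT lane R8, T-DEC: HALF-TOP LAWS ARE DEC AT EVERY LAYER — `2·y·M ≤ T·(1 + y)` suffices (no other hypothesis); hence EVERY forest of gated
# trees with `2·x·ftop L ≤ fmean L` is SDEC at its floor `x` — any width, any root gates, any sub-forests, NO oracle — e.g. all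
# `(R^A[q](R^B[s]))^k` with `s·(2A + B) ≤ A` (arm-1 gen 49, architect)

builds on p205010 (kernel theorem, internal audit signed; external expert review pending)

Support file (`--supports stmt-CriticalPhenomena-4575`), QUANT lane seat prim-quant-arm-1 (gen 49, architect), rung R8 of
`run/shared/lean/prim/quant/LADDER.md`; memo `run/shared/lean/prim/quant/prim-quant-arm-1-g49/ARCH-G49.md` §7.  Theorems only (no definitions), standard
axioms, no sorries.  Corollaries of the first-moment budget criterion (`flowAtT_of_budget`, `…QuantBudgetFlow`, ✓ p423876) through the low-ceiling criterion
(`…QuantLowCeiling`, filed in parallel; to keep this file independent of that module's build, the two low-ceiling lemmas it needs are re-proved here as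
`private` copies) and of the glued-sibling binder (`gluedSib`, `…QuantGluedForestSDEC`).

THE OBSERVATION.  In the low-ceiling criterion (a probability law on `{0..M}`, mean `T`, floor `y`, is DEC at every layer as soon as each positive low atom
`l` — `2l < T` — satisfies `y·(M − l) ≤ T − l`) the condition is hardest at the largest conceivable low atom `l = T/2`, where it reads `2·y·M ≤ T·(1 + y)`.
So **every law with `2·y·M ≤ T·(1 + y)` ('half-top': the mean is at least `2yM/(1+y)`, versus top-affordability `T ≥ y·M`) is DEC at floor `y` at every
layer `j′ < M`** (`decAt_all_of_halfTop`) — whatever its atoms.  For the gated forest law `gate (flaw L) a` (floor `a·x`, mean `a·fmean L`, top `ftop L`)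
the condition is `2·x·ftop L ≤ fmean L·(1 + a·x)`, monotone in `a`; at every `a ∈ (0,1]` it is implied by **`2·x·ftop L ≤ fmean L`**.  Hence:
* **`decAt_gate_flaw_of_halfTop`**: law-OK siblings, `0 < a ≤ 1`, `2·x·ftop L ≤ fmean L·(1 + a·x)` ⟹ `gate (flaw L) a` is DEC at `a·x` at every layer
  `j < ftop L` — the node's obligation at gate `a` DIRECTLY (no product/residual split, no equal gates, no oracle, no tree-built hypothesis);
* **`sdec_flaw_of_halfTop`**: law-OK siblings with `2·x·ftop L ≤ fmean L` ⟹ `SDEC x (ftop L) (flaw L)` — EVERY HALF-TOP FOREST IS SDEC AT ITS FLOOR,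
  unconditionally (the list form of `SiblingStep` holds on this family for free; so does the tree row);
* **`residDEC_of_halfTop`**: under `2·x·ftop L ≤ fmean L·(1 + a·x)` the residual `resid a (wco a L) L` (same floor, mean, top) is DEC at `a·x` at every
  layer as well (`ResidDECAt x a L`, README V431's node at this list and gate);
* **`sdec_gluedForest_smallPendant`**: identical glued siblings `(R^A[q](R^B[s]))^k` with a SMALL PENDANT GATE `s·(2A + B) ≤ A` (`2·qs·k(A+B) ≤ kq(A+Bs)`)
  are `SDEC (qs) (k(A+B))` for EVERY `k`, EVERY `0 < q < 1` — e.g. **the tied glued line `(R²[q](R s))^k` for `s ≤ 2/5` at every width**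
  (`sdec_tiedGluedForest_smallPendant`), `(R¹[q](R²[s]))^k` for `s ≤ 1/4`, `(R¹[q](R s))^k` for `s ≤ 1/3`.
WHY IT IS CHEAP: at a half-top law every positive low atom can be shipped to ANY atom above the target, giant or mid, at a torque cost `≤ T − l` per unit
(`usage_mul_le_of_safe`), and the zero atom at cost `T`; the torque identity `Σ μ(h)(h − T) = 0` pays for all of it.  COVERAGE (exact scan
explore/auto_scan.py: the a-dependent form certifies the residual on 19–52 % of the positive-low points of the identical glued census; together with the no-low
regime `a·fmean ≤ 4·rmin` (small `a`) it closes e.g. `(R²[q](R s))^k` at `s = 1/2` for every `k ≤ 8` and every `q`; the general budget criterion covers the rest).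

* **`decAt_all_of_halfTop`**, **`decAt_gate_flaw_of_halfTop`**, **`sdec_flaw_of_halfTop`**, **`residDEC_of_halfTop`**;
* `gluedSib_lawOK`, **`sdec_gluedForest_smallPendant`**, **`sdec_tiedGluedForest_smallPendant`**;
* WIDTHS (no-low ∪ half-top, gate by gate): `halfTop_of_widthBound`, **`sdec_gluedForest_lt_of_widthBound`**, **`sdec_gluedForest_of_widthBound`**
  (`k·(s(2A+B) − A) ≤ 4A·s` ⟹ `(R^A[q](R^B[s]))^k` SDEC at its floor), **`sdec_tiedGluedForest`** (`(R²[q](R s))^k` for `s(5k − 8) ≤ 2k`: `k = 4`: `s ≤ 2/3`,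
  `k = 8`: `s ≤ 1/2`, all `k`: `s ≤ 2/5`), **`sdec_tiedGluedForest_half`** (`s = 1/2`, every `q`, every `k ≤ 8`);
* by name in typer g41's schema (`…QuantResidDEC`, ✓ p421540): **`residDECOn_halfTop`** (`ResidDECOn` on `SibFam₃ ∧ 2x·ftop ≤ fmean`) and
  **`residDECOn_heavyRoots`** (`ResidDECOn` on `SibFam₃ ∧` equal root gates `∧` sub-forests vanishing below `R` `∧ fmean ≤ 4R`).

HONEST STATUS: an unconditional SDEC family (half-top forests) and DEC criteria; `ResidDEC`, `SiblingStep`, `GateStepN`, `FarTreeRow` OPEN; RATE class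
log\* / honest sentence of `run/shared/lean/prim/quant/README.md` unchanged.  [this work]; budget / low-ceiling criteria: this seat; flow normal form: this lane
(typer g22–g26).  Nothing here is cited as a published result.  The gluing rows served [cite: KozmaNitzan2024, Conjecture 3 (p. 15)]; product measure
[cite: Grimmett1999, §1.3 p. 10].
-/

noncomputable section

open scoped BigOperators

namespace Summit.CriticalPhenomena.PercolationContinuityZ3.Theorems
namespace Quant
namespace LawDec

open Finset

/-! ### Private copies of the low-ceiling lemmas (module `…QuantLowCeiling` is filed in parallel) -/

/-- the budget inequality at ceiling `M` is the torque identity (private copy of `demand_le_budget_top`). -/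
private theorem demand_le_budget_top' (M : ℕ) (μ : ℕ → ℝ) (T : ℝ) (hμ0 : ∀ h, 0 ≤ μ h)
    (hmom : T * ∑ h ∈ Finset.range (M + 1), μ h ≤ ∑ h ∈ Finset.range (M + 1), (h : ℝ) * μ h) :
    ∑ l ∈ Finset.range (M + 1), (if (1 ≤ l ∧ 2 * (l : ℝ) < T) then μ l * (T - l) else 0)
      ≤ ∑ h ∈ Finset.range (M + 1), (if (T < (h : ℝ) ∧ h ≤ M) then μ h * ((h : ℝ) - T) else 0) := by
  have hpt : ∀ h ∈ Finset.range (M + 1),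
      (if (1 ≤ h ∧ 2 * (h : ℝ) < T) then μ h * (T - h) else 0) - (if (T < (h : ℝ) ∧ h ≤ M) then μ h * ((h : ℝ) - T) else 0)
        ≤ (T - h) * μ h := by
    intro h hh
    have hhM : h ≤ M := by rw [Finset.mem_range] at hh; omega
    have hμ := hμ0 h
    by_cases h1 : 1 ≤ h ∧ 2 * (h : ℝ) < T
    · have h2 : ¬ (T < (h : ℝ) ∧ h ≤ M) := fun hc => by linarith [hc.1, h1.2, (Nat.cast_nonneg h : (0 : ℝ) ≤ h)]
      rw [if_pos h1, if_neg h2]; linarith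
    · rw [if_neg h1]
      by_cases h2 : T < (h : ℝ) ∧ h ≤ M
      · rw [if_pos h2]; linarith
      · rw [if_neg h2]
        have hTh : (h : ℝ) ≤ T := by
          by_contra hlt
          exact h2 ⟨not_le.1 hlt, hhM⟩
        nlinarith
  have hsum := Finset.sum_le_sum hpt
  rw [Finset.sum_sub_distrib] at hsum
  have e : ∑ h ∈ Finset.range (M + 1), (T - h) * μ h
      = T * ∑ h ∈ Finset.range (M + 1), μ h - ∑ h ∈ Finset.range (M + 1), (h : ℝ) * μ h := by
    rw [Finset.mul_sum, ← Finset.sum_sub_distrib]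
    exact Finset.sum_congr rfl fun h _ => by ring
  rw [e] at hsum
  linarith

/-- the low-ceiling criterion (private copy of `decAt_all_of_lowCeiling`): every charged positive low atom `l` with `y·(M − l) ≤ T − l` ⟹ DEC at every
layer. -/
private theorem decAt_all_of_lowCeiling' (y : ℝ) (M : ℕ) (μ : ℕ → ℝ) (T : ℝ) (hy0 : 0 < y) (hy1 : y < 1)
    (hμ0 : ∀ h, 0 ≤ μ h) (hμM : ∀ h, M < h → μ h = 0) (hμ1 : ∑ h ∈ Finset.range (M + 1), μ h = 1)
    (hT : ∑ h ∈ Finset.range (M + 1), (h : ℝ) * μ h = T) (hT0 : 0 < T) (hta : y * (M : ℝ) ≤ T)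
    (hceil : ∀ l : ℕ, 1 ≤ l → 2 * (l : ℝ) < T → 0 < μ l → y * ((M : ℝ) - l) ≤ T - l) :
    ∀ j', j' < M → DECAt y j' M μ := by
  intro j' hj'
  have hmom : T * ∑ h ∈ Finset.range (M + 1), μ h ≤ ∑ h ∈ Finset.range (M + 1), (h : ℝ) * μ h := by
    rw [hμ1, hT, mul_one]
  rw [decAt_iff_decAtT, hT]
  exact decAtT_of_flowAtT y T j' M μ hy0 hy1 hμM hμ1
    (flowAtT_of_budget y T j' M M μ hy0 hy1 hT0 hj' hμ0 hμM hta hmom hceil (demand_le_budget_top' M μ T hμ0 hmom))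

/-! ### Half-top laws -/

/-- **HALF-TOP LAWS ARE DEC AT EVERY LAYER.**  A probability law `μ` on `{0..M}` with mean `T > 0` and floor `0 < y < 1` satisfying `2·y·M ≤ T·(1 + y)`
is `DECAt y j′ M μ` for every `j′ < M` — whatever its atoms (every positive low atom `l < T/2` is below the ceiling `(T − yM)/(1 − y)`;
`decAt_all_of_lowCeiling`). [this work] -/
theorem decAt_all_of_halfTop (y : ℝ) (M : ℕ) (μ : ℕ → ℝ) (T : ℝ) (hy0 : 0 < y) (hy1 : y < 1)
    (hμ0 : ∀ h, 0 ≤ μ h) (hμM : ∀ h, M < h → μ h = 0) (hμ1 : ∑ h ∈ Finset.range (M + 1), μ h = 1)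
    (hT : ∑ h ∈ Finset.range (M + 1), (h : ℝ) * μ h = T) (hT0 : 0 < T) (hhalf : 2 * y * (M : ℝ) ≤ T * (1 + y)) :
    ∀ j', j' < M → DECAt y j' M μ := by
  have hta : y * (M : ℝ) ≤ T := by nlinarith
  refine decAt_all_of_lowCeiling' y M μ T hy0 hy1 hμ0 hμM hμ1 hT hT0 hta (fun l _ hlow _ => ?_)
  nlinarith

/-! ### Half-top forests -/

/-- **THE NODE'S OBLIGATION AT GATE `a` FOR A HALF-TOP FOREST, DIRECTLY.**  Law-OK siblings (`0 < qᵢ < 1`, `ρᵢ` probability laws) with `0 < fmean L`,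
floor `0 < x`, outer gate `0 < a ≤ 1` with `a·x < 1`, and `2·x·ftop L ≤ fmean L·(1 + a·x)`: the gated forest law `gate (flaw L) a` is DEC at floor `a·x` at
every layer below the top.  No product/residual split, no equal gates, no oracle. [this work] -/
theorem decAt_gate_flaw_of_halfTop {x a : ℝ} (hx0 : 0 < x) (ha0 : 0 < a) (ha1 : a ≤ 1) (hax1 : a * x < 1) (L : List Sib)
    (hL : ∀ s ∈ L, s.LawOK) (hm : 0 < fmean L) (hhalf : 2 * x * (ftop L : ℝ) ≤ fmean L * (1 + a * x)) :
    ∀ j, j < ftop L → DECAt (a * x) j (ftop L) (gate (flaw L) a) := by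
  obtain ⟨f0, fM, f1, fmn⟩ := flaw_facts L hL
  obtain ⟨g0, gM, g1⟩ := gate_laws (ftop L) (flaw L) a ha0.le ha1 f0 fM f1
  have gmn : ∑ h ∈ Finset.range (ftop L + 1), (h : ℝ) * gate (flaw L) a h = a * fmean L := by rw [sum_mul_gate, fmn]
  refine decAt_all_of_halfTop (a * x) (ftop L) (gate (flaw L) a) (a * fmean L) (mul_pos ha0 hx0) hax1 g0 gM g1 gmn (mul_pos ha0 hm) ?_
  have := mul_le_mul_of_nonneg_left hhalf ha0.le
  nlinarith

/-- **EVERY HALF-TOP FOREST IS SDEC AT ITS FLOOR.**  Law-OK siblings with `0 < fmean L`, a floor `0 < x < 1` with `2·x·ftop L ≤ fmean L`: then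
`SDEC x (ftop L) (flaw L)` — for every outer gate `a ∈ (0,1]`, `2x·ftop ≤ fmean ≤ fmean·(1 + a x)`.  Any width, any root gates, any sub-forest laws, no
oracle. [this work] -/
theorem sdec_flaw_of_halfTop {x : ℝ} (hx0 : 0 < x) (hx1 : x < 1) (L : List Sib) (hL : ∀ s ∈ L, s.LawOK) (hm : 0 < fmean L)
    (hhalf : 2 * x * (ftop L : ℝ) ≤ fmean L) : SDEC x (ftop L) (flaw L) := by
  intro a ha0 ha1 j hj
  refine decAt_gate_flaw_of_halfTop hx0 ha0 ha1 (by nlinarith) L hL hm ?_ j hj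
  nlinarith [mul_pos ha0 hx0]

/-- **RESID-DEC FOR A HALF-TOP FOREST.**  Tree-built siblings (at least two) at floor `0 < x < 1`, `0 < a < 1`, `2·x·ftop L ≤ fmean L·(1 + a·x)`: the
residual `resid a (wco a L) L` — same floor `a·x`, mean `a·fmean L`, top `ftop L` as the gated forest — is DEC at `a·x` at every layer (`ResidDECAt x a L`).
[this work] -/
theorem residDEC_of_halfTop {x a : ℝ} (hx0 : 0 < x) (hx1 : x < 1) (ha0 : 0 < a) (ha1 : a < 1) (L : List Sib)
    (hL : ∀ s ∈ L, s.TreeOK x) (hk : 2 ≤ L.length) (hhalf : 2 * x * (ftop L : ℝ) ≤ fmean L * (1 + a * x)) :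
    ∀ j, j < ftop L → DECAt (a * x) j (ftop L) (resid a (wco a L) L) := by
  have hL' : ∀ s ∈ L, s.LawOK := fun s hs => (hL s hs).lawOK
  have hne : L ≠ [] := by rintro rfl; simp at hk
  obtain ⟨s, t, L', rfl⟩ : ∃ s t L', L = s :: t :: L' := by
    rcases L with _ | ⟨s, _ | ⟨t, L'⟩⟩
    · exact absurd rfl hne
    · simp at hk
    · exact ⟨s, t, L', rfl⟩
  have hw1 : wco a (s :: t :: L') < 1 := wco_lt_one ha1 s t L' hL'
  obtain ⟨r0, rM, r1, rmn⟩ := resid_laws ha0 ha1.le (s :: t :: L') hL' le_rfl hw1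
  have hax0 : 0 < a * x := mul_pos ha0 hx0
  have hax1 : a * x < 1 := by nlinarith
  have hT0 : 0 < a * fmean (s :: t :: L') := mul_pos ha0 ((fmean_pos _ hL).2 hne)
  refine decAt_all_of_halfTop (a * x) (ftop (s :: t :: L')) (resid a (wco a (s :: t :: L')) (s :: t :: L')) (a * fmean (s :: t :: L'))
    hax0 hax1 r0 rM r1 rmn hT0 ?_
  have h0 := mul_le_mul_of_nonneg_left hhalf ha0.le
  nlinarith [mul_pos ha0 hx0]

/-! ### Identical glued siblings with a small pendant gate -/

/-- law-level validity of the glued sibling `R^A[q](R^B[s])` (`0 < q < 1`, `0 < s < 1`). [this work] -/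
theorem gluedSib_lawOK (A B : ℕ) {q s : ℝ} (hq0 : 0 < q) (hq1 : q < 1) (hs0 : 0 < s) (hs1 : s < 1) (x₁ : ℝ) :
    (gluedSib A B q s x₁).LawOK := by
  obtain ⟨_, _, ρ0, ρM, ρ1, _⟩ := (gluedSib_treeBuiltN A B hs0 hs1 (by norm_num : (0 : ℝ) < 1 / 2) (by norm_num)).lawFacts
  exact ⟨hq0, hq1, ρ0, ρM, ρ1⟩

/-- **IDENTICAL GLUED SIBLINGS WITH A SMALL PENDANT GATE ARE SDEC AT EVERY WIDTH.**  `A ≥ 1`, `0 < q < 1`, `0 < s < 1` with `s·(2A + B) ≤ A` (so that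
`2·qs·k(A+B) ≤ kq(A + Bs)`): for every `k`, the forest law of `k` copies of `R^A[q](R^B[s])` is `SDEC (qs) (k(A+B))` — no oracle, no certificate. [this work] -/
theorem sdec_gluedForest_smallPendant (k A B : ℕ) (hA : 1 ≤ A) {q s : ℝ} (hq0 : 0 < q) (hq1 : q < 1) (hs0 : 0 < s) (hs1 : s < 1)
    (hsmall : s * (2 * (A : ℝ) + B) ≤ A) :
    SDEC (q * s) (k * (A + B)) (flaw (List.replicate k (gluedSib A B q s s))) := by
  rcases Nat.eq_zero_or_pos k with hk | hk
  · subst hk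
    intro a _ _ j hj
    simp at hj
  have hqs0 : 0 < q * s := mul_pos hq0 hs0
  have hqs1 : q * s < 1 := by nlinarith
  have hL : ∀ t ∈ List.replicate k (gluedSib A B q s s), t.LawOK := fun t ht => by
    rw [List.eq_of_mem_replicate ht]; exact gluedSib_lawOK A B hq0 hq1 hs0 hs1 s
  have hA0 : (0 : ℝ) < A := by exact_mod_cast hA
  have hk0 : (0 : ℝ) < k := by exact_mod_cast hk
  have hfm : fmean (List.replicate k (gluedSib A B q s s)) = (k : ℝ) * (q * ((A : ℝ) + (B : ℝ) * s)) := by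
    rw [fmean_replicate, gluedSib_mean]; rfl
  have hft : ftop (List.replicate k (gluedSib A B q s s)) = k * (A + B) := by rw [ftop_replicate]; rfl
  have hm : 0 < fmean (List.replicate k (gluedSib A B q s s)) := by
    rw [hfm]
    have : (0 : ℝ) < (A : ℝ) + (B : ℝ) * s := by positivity
    positivity
  have h := sdec_flaw_of_halfTop hqs0 hqs1 (List.replicate k (gluedSib A B q s s)) hL hm (by
    rw [hfm, hft]; push_cast
    have hB0 : (0 : ℝ) ≤ B := Nat.cast_nonneg B
    nlinarith [mul_nonneg hk0.le hq0.le, mul_le_mul_of_nonneg_left hsmall (mul_nonneg hk0.le hq0.le)])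
  rwa [hft] at h


/-! ### In the node's schema -/

/-- **`ResidDECOn` ON THE HALF-TOP FAMILY**: for lists of `≥ 3` tree-OK siblings with `2·x·ftop L ≤ fmean L`, RESID-DEC holds at every outer gate
(typer g41's schema `ResidDECOn`, README V431's node of record restricted to this family — a theorem). [this work] -/
theorem residDECOn_halfTop : ResidDECOn (fun x L => SibFam₃ x L ∧ 2 * x * (ftop L : ℝ) ≤ fmean L) := by
  intro x L hx0 hx1 hfam a ha0 ha1
  obtain ⟨⟨hL, hk⟩, hhalf⟩ := hfam
  refine residDEC_of_halfTop hx0 hx1 ha0 ha1 L hL (by omega) (hhalf.trans ?_)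
  have hm : 0 ≤ fmean L := (fmean_pos L hL).1
  nlinarith [mul_pos ha0 hx0]

/-- **`ResidDECOn` ON THE HEAVY-ROOT FAMILY**: lists of `≥ 3` tree-OK siblings with EQUAL root gates, sub-forest laws vanishing below some `R` with
`fmean L ≤ 4R` (the no-low regime of `…QuantRootScaledHeavyRoots`, at every outer gate). [this work] -/
theorem residDECOn_heavyRoots :
    ResidDECOn (fun x L => SibFam₃ x L ∧ (∃ q₀ : ℝ, ∀ u ∈ L, u.q = q₀) ∧
      ∃ R : ℕ, (∀ s ∈ L, ∀ h, h < R → s.ρ h = 0) ∧ fmean L ≤ 4 * (R : ℝ)) := by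
  intro x L hx0 hx1 hfam a ha0 ha1
  obtain ⟨⟨hL, hk⟩, ⟨q₀, hq⟩, R, hR, hfm⟩ := hfam
  have hL' : ∀ s ∈ L, s.LawOK := fun s hs => (hL s hs).lawOK
  have hne : L ≠ [] := by rintro rfl; simp at hk
  obtain ⟨s, t, L', rfl⟩ : ∃ s t L', L = s :: t :: L' := by
    rcases L with _ | ⟨s, _ | ⟨t, L'⟩⟩
    · exact absurd rfl hne
    · simp at hk
    · exact ⟨s, t, L', rfl⟩
  have hm : 0 ≤ fmean (s :: t :: L') := (fmean_pos _ hL).1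
  exact decAt_resid_of_noLow hx0 hx1 ha0 ha1.le R q₀ (s :: t :: L') hL hq hR (wco_lt_one ha1 s t L' hL') (by nlinarith)

/-- **THE TIED GLUED LINE AT EVERY WIDTH for `s ≤ 2/5`**: `(R²[q](R s))^k` is `SDEC (qs) (3k)` for every `k`, every `0 < q < 1`, `0 < s ≤ 2/5`. [this work] -/
theorem sdec_tiedGluedForest_smallPendant (k : ℕ) {q s : ℝ} (hq0 : 0 < q) (hq1 : q < 1) (hs0 : 0 < s) (hs : s ≤ 2 / 5) :
    SDEC (q * s) (k * 3) (flaw (List.replicate k (gluedSib 2 1 q s s))) := by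
  have h := sdec_gluedForest_smallPendant k 2 1 (by norm_num) hq0 hq1 hs0 (by linarith) (by push_cast; linarith)
  simpa using h


/-! ### Widths: the no-low and half-top regimes overlap -/

/-- the point mass `δ_K` -/
local notation3 "δ[" K "]" => (fun k : ℕ => if k = (K : ℕ) then (1 : ℝ) else 0)

/-- **the arithmetic of the overlap**: with `u = A + B·s > 0`, `0 < q`, `0 ≤ x ≤ q·s`, `k ≥ 0`, the width bound `k·(s(2A+B) − A) ≤ 4A·s` and the
failure of the no-low regime `4A < a·k·q·u`, the half-top inequality `2·x·(k(A+B)) ≤ k·q·u·(1 + a·x)` holds. [this work] -/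
theorem halfTop_of_widthBound {k A B q s a x : ℝ} (hk : 0 ≤ k) (hA : 0 < A) (hB : 0 ≤ B) (hq0 : 0 < q) (hs0 : 0 < s)
    (hx0 : 0 ≤ x) (hxs : x ≤ q * s)
    (hkb : k * (s * (2 * A + B) - A) ≤ 4 * A * s) (hband : 4 * A < a * (k * (q * (A + B * s)))) :
    2 * x * (k * (A + B)) ≤ k * (q * (A + B * s)) * (1 + a * x) := by
  -- the margin is affine in `x`, positive at `x = 0`, nonnegative at `x = q s`
  have hu : 0 < A + B * s := by positivity
  have hend : 2 * (q * s) * (k * (A + B)) ≤ k * (q * (A + B * s)) * (1 + a * (q * s)) := by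
    -- `k q [u + a q s u − 2 s (A+B)] ≥ 0` from `a k q u > 4A` and the width bound
    have h1 : k * (s * (2 * A + B) - A) ≤ 4 * A * s := hkb
    have h2 : 4 * A * s < a * (k * (q * (A + B * s))) * s := by nlinarith
    nlinarith [mul_pos hq0 hs0, mul_nonneg hk hq0.le]
  have h0 : 0 ≤ k * (q * (A + B * s)) := by positivity
  -- interpolate: x = θ·(q s) with θ ∈ [0,1]
  have hqs : 0 < q * s := mul_pos hq0 hs0
  set θ := x / (q * s) with hθ
  have hθ0 : 0 ≤ θ := div_nonneg hx0 hqs.le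
  have hθ1 : θ ≤ 1 := (div_le_one hqs).2 hxs
  have hxθ : x = θ * (q * s) := by rw [hθ, div_mul_cancel₀ _ hqs.ne']
  rw [hxθ]
  nlinarith [mul_nonneg hθ0 h0, mul_nonneg (sub_nonneg.2 hθ1) h0, mul_le_mul_of_nonneg_left hend hθ0]

/-- **IDENTICAL GLUED FORESTS UNDER THE WIDTH BOUND, below the floor**: `A, B ≥ 1`, `0 < q < 1`, `0 < s < 1`, `k·(s(2A+B) − A) ≤ 4A·s`, `0 < x < qs`:
the forest law of `k` copies of `R^A[q](R^B[s])` is `SDEC x (k(A+B))` — gate by gate, no-low (`a·kqu ≤ 4A`) or half-top (otherwise). [this work] -/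
theorem sdec_gluedForest_lt_of_widthBound (k A B : ℕ) (hA : 1 ≤ A) (hB : 1 ≤ B) {q s : ℝ} (hq0 : 0 < q) (hq1 : q < 1) (hs0 : 0 < s)
    (hs1 : s < 1) (hkb : (k : ℝ) * (s * (2 * (A : ℝ) + B) - A) ≤ 4 * (A : ℝ) * s) {x : ℝ} (hx0 : 0 < x) (hx : x < q * s) :
    SDEC x (k * (A + B)) (flaw (List.replicate k (gluedSib A B q s s))) := by
  rcases Nat.eq_zero_or_pos k with hk | hk
  · subst hk; intro a _ _ j hj; simp at hj
  have hqs0 : 0 < q * s := mul_pos hq0 hs0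
  have hqs1 : q * s < 1 := by nlinarith
  have hx1 : x < 1 := hx.trans hqs1
  -- the recorded floor `s·y` with `x = q·(s·y)`
  set y : ℝ := x / (q * s) with hy
  have hy0 : 0 < y := div_pos hx0 hqs0
  have hy1 : y < 1 := (div_lt_one hqs0).2 hx
  have hxy : x ≤ q * (s * y) := by
    rw [hy, ← mul_assoc, mul_div_cancel₀ _ hqs0.ne']
  set g : Sib := gluedSib A B q s (s * y) with hg
  have hT : g.TreeOK x := gluedSib_treeOK A B hA hB hq0 hq1 hs0 hs1 hy0 hy1 hxy
  have hmem : ∀ t ∈ List.replicate k g, t = g := fun t ht => List.eq_of_mem_replicate ht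
  have hL : ∀ t ∈ List.replicate k g, t.TreeOK x := fun t ht => by rw [hmem t ht]; exact hT
  have hL' : ∀ t ∈ List.replicate k g, t.LawOK := fun t ht => (hL t ht).lawOK
  have hq : ∀ t ∈ List.replicate k g, t.q = q := fun t ht => by rw [hmem t ht, hg]; rfl
  have hρ : ∀ t ∈ List.replicate k g, SDEC t.x₁ t.M t.ρ := fun t ht => by
    rw [hmem t ht]
    show SDEC (s * y) (A + B) (slice δ[A] B s)
    exact gluedSib_sdec A B (mul_pos hs0 hy0) (by nlinarith) (by nlinarith) hs1.le
  have hR : ∀ t ∈ List.replicate k g, ∀ h, h < A → t.ρ h = 0 := fun t ht h hh => by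
    rw [hmem t ht]
    exact gluedSib_rho_below A B hA hB s h hh
  have hne : List.replicate k g ≠ [] := by
    intro h; have := congrArg List.length h; simp at this; omega
  have hfm : fmean (List.replicate k g) = (k : ℝ) * (q * ((A : ℝ) + (B : ℝ) * s)) := by rw [fmean_replicate, hg, gluedSib_mean]; rfl
  have hft : ftop (List.replicate k g) = k * (A + B) := by rw [ftop_replicate, hg]; rfl
  have hm : 0 < fmean (List.replicate k g) := (fmean_pos _ hL).2 hne
  have hA0 : (0 : ℝ) < A := by exact_mod_cast hA
  -- the law we certify is the one with recorded floor `s·y`; transfer at the end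
  have key : SDEC x (ftop (List.replicate k g)) (flaw (List.replicate k g)) := by
    intro a ha0 ha1 j hj
    rcases eq_or_lt_of_le ha1 with rfl | hlt
    · rw [gate_one, one_mul]
      exact decAt_flaw_of_sdec hx0 hx1 _ hL hρ j
    · by_cases hreg : a * fmean (List.replicate k g) ≤ 4 * (A : ℝ)
      · exact decAt_gate_flaw_heavyRoots hx0 hx1 ha0 hlt A _ hne hL hq hρ hR hreg j hj
      · refine decAt_gate_flaw_of_halfTop hx0 ha0 ha1 (by nlinarith) _ hL' hm ?_ j hj
        rw [hfm, hft]
        rw [hfm] at hreg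
        push_cast
        exact halfTop_of_widthBound (Nat.cast_nonneg k) hA0 (Nat.cast_nonneg B) hq0 hs0 hx0.le hx.le hkb (not_le.1 hreg)
  rw [ftop_replicate, hg, flaw_replicate_gluedSib k A B q s (s * y) s] at key
  exact key

/-- **IDENTICAL GLUED FORESTS UNDER THE WIDTH BOUND ARE SDEC AT THEIR FLOOR `qs`** (`sdec_of_forall_lt`). [this work] -/
theorem sdec_gluedForest_of_widthBound (k A B : ℕ) (hA : 1 ≤ A) (hB : 1 ≤ B) {q s : ℝ} (hq0 : 0 < q) (hq1 : q < 1) (hs0 : 0 < s)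
    (hs1 : s < 1) (hkb : (k : ℝ) * (s * (2 * (A : ℝ) + B) - A) ≤ 4 * (A : ℝ) * s) :
    SDEC (q * s) (k * (A + B)) (flaw (List.replicate k (gluedSib A B q s s))) := by
  have hqs0 : 0 < q * s := mul_pos hq0 hs0
  have hqs1 : q * s < 1 := by nlinarith
  have hL : ∀ t ∈ List.replicate k (gluedSib A B q s s), t.LawOK := fun t ht => by
    rw [List.eq_of_mem_replicate ht]; exact gluedSib_lawOK A B hq0 hq1 hs0 hs1 s
  obtain ⟨_, fM, _, _⟩ := flaw_facts _ hL
  rw [ftop_replicate] at fM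
  exact sdec_of_forall_lt hqs0 hqs1 fM (fun x hx0 hx => sdec_gluedForest_lt_of_widthBound k A B hA hB hq0 hq1 hs0 hs1 hkb hx0 hx)

/-- **THE TIED GLUED LINE AT WIDTH `k`**: `(R²[q](R s))^k` is `SDEC (qs) (3k)` for every `0 < q < 1` and `0 < s < 1` with `s·(5k − 8) ≤ 2k` (`k = 4`:
`s ≤ 2/3`; `k = 8`: `s ≤ 1/2`; every `k`: `s ≤ 2/5`). [this work] -/
theorem sdec_tiedGluedForest (k : ℕ) {q s : ℝ} (hq0 : 0 < q) (hq1 : q < 1) (hs0 : 0 < s) (hs1 : s < 1)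
    (hks : s * (5 * (k : ℝ) - 8) ≤ 2 * k) :
    SDEC (q * s) (k * 3) (flaw (List.replicate k (gluedSib 2 1 q s s))) := by
  have h := sdec_gluedForest_of_widthBound k 2 1 (by norm_num) le_rfl hq0 hq1 hs0 hs1 (by push_cast; nlinarith)
  simpa using h

/-- **THE TIED GLUED LINE AT `s = 1/2`, EVERY WIDTH UP TO EIGHT**: `(R²[q](R ½))^k`, `k ≤ 8`, is `SDEC (q/2) (3k)` for every `0 < q < 1`. [this work] -/
theorem sdec_tiedGluedForest_half (k : ℕ) (hk : k ≤ 8) {q : ℝ} (hq0 : 0 < q) (hq1 : q < 1) :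
    SDEC (q * (1 / 2)) (k * 3) (flaw (List.replicate k (gluedSib 2 1 q (1 / 2) (1 / 2)))) := by
  have hk' : (k : ℝ) ≤ 8 := by exact_mod_cast hk
  exact sdec_tiedGluedForest k hq0 hq1 (by norm_num) (by norm_num) (by nlinarith)



end LawDec
end Quant
end Summit.CriticalPhenomena.PercolationContinuityZ3.Theorems
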